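import Literature.NumberTheory.IwasawaTheory.ClassicalMuVanishesUnitNormIndex
import Literature.NumberTheory.IwasawaTheory.CyclotomicTwoTotallyRamifiedOddIndex
import HarnessLib

/-!
# Route `ByReductionTypeAtTwo` (rung K4), crux C1″ `FineSelmerConjAAtTwoAdditivePotGood` (item stmt-BirchSwinnertonDyer-22615):
# CHEVALLEY'S DOOR AT `p = 2` — `e₁ = 0` (odd class number of the first layer `K(√2)`) from an odd `h_K`, at most two primes above `2`,
# and ONE unit of `K` that is not a norm from `K(√2)`
# (a `--supports 22615` toolkit file; seat `bsd-2adic-k4-w1` GEN 6; the `p = 2` companion of the tree's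
# `IwasawaTheory.classNumberPExp_one_eq_zero_of_relIndex_mul_eq` (cell bsd-potss), which assumes `p` odd)

HONEST FRAMING (cell `bsd-2adic`, D-0036/D-0054): UNCONDITIONAL theorems (Chevalley's ambiguous class number formula is a TREE THEOREM,
`AmbiguousClass.ambiguousClassNumberFormula`); closes nothing; nothing booked; BSD is not proved by any of this.

PURPOSE: after GEN 6's class-number certificates, 12 census rows of C1″ carry exactly ONE displayed bit, `e₁ = 0` = «`2 ∤ h(ℚ(P)(√2))`»
(PARI `cyc6 = []`). Chevalley (Lang, *Cyclotomic Fields* Ch. 13 §4 Lemma 4.1) for the quadratic layer `L = K(√2)`: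
`#Cl(L)^G · 2 · [E_K : E_K ∩ N_{L/K} Lˣ] = h_K · ∏_𝔭 e_𝔭 · e_∞`. Here `e_∞ = 1` (§1: `√2` is real, so `L/K` is unramified at the infinite
places although `K` need not be totally real), `∏ e_𝔭 = 2^t` with `t ≤ #{𝔭 ∣ 2} ≤ 2`, and ONE unit of `K` outside `N_{L/K} Lˣ` makes the
norm index even (§2: its coset has order `2`, squares being norms); with `h_K` odd this forces `t = 2`, index `2`, `#Cl(L)^G = h_K` odd, and the
fixed-point count of the `2`-group `G` on `Cl(L)[2]` gives `2 ∤ h_L` (tree `not_dvd_classNumber_of_isPGroup_of_not_dvd_card_fixed`). §3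
specialises to the first layer of the cyclotomic `ℤ₂`-extension of a field of odd degree (`√2 ∈ K₁`, tree p687770): **`classNumberPExp κ 1 = 0`**.
The non-norm unit is certified `2`-adically in the companion file `…ChevalleyNonNormCertificate`.

References: [Lang1990] Ch. 13 §4 Lemma 4.1; [Washington1997] §13.1; [Gras2003] II.6.2 (genus theory), IV.4.
-/

set_option autoImplicit false
-- sibling precedent (`…ClassNumberOneCriterion.lean`): the directory name repeats the summit name
set_option linter.dupNamespace false

noncomputable section

open scoped Classical NumberField nonZeroDivisors

namespace Summit.BirchSwinnertonDyer.BirchSwinnertonDyer.Theorems.AddKatoTwo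

open NumberField IsDedekindDomain
open Literature.NumberTheory.NumberFields Literature.NumberTheory.NumberFields.AmbiguousClass
  Literature.NumberTheory.GaloisRepresentations
  Literature.NumberTheory.GaloisRepresentations.Herbrand Literature.NumberTheory.GaloisRepresentations.MinkowskiUnit
  Literature.NumberTheory.GaloisRepresentations.CyclicNormIndex Literature.NumberTheory.IwasawaTheory
  Literature.NumberTheory.EllipticCurves

/-! ## §1 `K(√2)/K` is unramified at the infinite places -/

section Infinite

variable {K L : Type} [Field K] [NumberField K] [Field L] [NumberField L] [Algebra K L]

omit [NumberField K] in
/-- **`L = K + K·s` with `s² = 2` is unramified over `K` at every infinite place**: a complex embedding `φ` of `L` that is real on `K`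
has `φ(s)² = 2`, so `φ(s) ∈ ℝ` and `φ` is real on `L`. (No total reality of `K` is needed.) [cite: Washington1997, §13.1]
[cite: Lang1990, Ch. 13 §4 (e(v) at archimedean v)] -/
theorem isUnramifiedAtInfinitePlaces_of_sq_eq_two {s : L} (hs : s ^ 2 = 2)
    (hspan : ∀ x : L, ∃ a b : K, x = algebraMap K L a + algebraMap K L b * s) : IsUnramifiedAtInfinitePlaces K L := by
  refine ⟨fun w => ?_⟩
  by_contra hw
  rw [InfinitePlace.not_isUnramified_iff] at hw
  obtain ⟨hc, hr⟩ := hw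
  rw [← InfinitePlace.mk_embedding w] at hc hr
  rw [InfinitePlace.comap_mk, InfinitePlace.isReal_mk_iff] at hr
  rw [InfinitePlace.isComplex_mk_iff] at hc
  apply hc
  set φ := InfinitePlace.embedding w with hφ
  -- `φ s` is real: its square is `2`
  have hφs : starRingEnd ℂ (φ s) = φ s := by
    have h2 : φ s ^ 2 = 2 := by rw [← map_pow, hs, map_ofNat]
    have him : (φ s).im = 0 := by
      have hre : (φ s ^ 2).im = 0 := by rw [h2]; simp
      have hre2 : (φ s ^ 2).re = 2 := by rw [h2]; simp
      rw [sq, Complex.mul_im] at hre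
      rw [sq, Complex.mul_re] at hre2
      by_contra hne
      have hprod : (φ s).re * (φ s).im = 0 := by linarith
      rcases mul_eq_zero.mp hprod with h0 | h0
      · rw [h0] at hre2
        nlinarith [mul_self_nonneg (φ s).im]
      · exact hne h0
    exact Complex.conj_eq_iff_im.mpr him
  -- hence `φ` is real on `L = K + K s`
  have ha : ∀ a : K, starRingEnd ℂ (φ (algebraMap K L a)) = φ (algebraMap K L a) := fun a => by
    have := RingHom.congr_fun (ComplexEmbedding.isReal_iff.mp hr) a
    rw [ComplexEmbedding.conjugate_coe_eq] at this
    exact this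
  rw [ComplexEmbedding.isReal_iff]
  ext x
  obtain ⟨a, b, rfl⟩ := hspan x
  rw [ComplexEmbedding.conjugate_coe_eq, map_add, map_mul, map_add, map_mul, hφs, ha a, ha b]

end Infinite

/-! ## §2 Chevalley in degree `2`: the norm index is even, and `2 ∤ h_L` -/

section Chevalley

variable {K L : Type} [Field K] [NumberField K] [Field L] [NumberField L] [Algebra K L]

/-- **A unit of `K` outside `N_{L/K} Lˣ` makes the norm index `[E_K : E_K ∩ N Lˣ]` even**: its square is a norm (`N(ι ε) = (ι ε)^{[L:K]}`
for an element of `K`; here `[L:K] = 2`), so its coset has order exactly `2`. [cite: Lang1990, Ch. 13 §4, proof of Lemma 4.2] -/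
theorem two_dvd_relIndex_of_nonNorm [IsGalois K L] (hdeg : Module.finrank K L = 2) {u : Lˣ}
    (hu : u ∈ unitsE L ⊓ (unitsIncl K L).range)
    (hnot : u ∉ unitsE L ⊓ (⊤ : Subgroup Lˣ).map (Herbrand.norm (L ≃ₐ[K] L))) :
    2 ∣ (unitsE L ⊓ (⊤ : Subgroup Lˣ).map (Herbrand.norm (L ≃ₐ[K] L))).relIndex (unitsE L ⊓ (unitsIncl K L).range) := by
  haveI : FiniteDimensional K L := Module.Finite.of_restrictScalars_finite ℚ K L
  set H := unitsE L ⊓ (⊤ : Subgroup Lˣ).map (Herbrand.norm (L ≃ₐ[K] L)) with hH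
  set E := unitsE L ⊓ (unitsIncl K L).range with hE
  -- `u² = N(u)` since `u ∈ K` is fixed by every `g`
  have hcard : Fintype.card (L ≃ₐ[K] L) = 2 := by rw [← Nat.card_eq_fintype_card, IsGalois.card_aut_eq_finrank, hdeg]
  have hfix : ∀ g : L ≃ₐ[K] L, g • u = u := by
    intro g
    obtain ⟨c, hc⟩ := hu.2
    apply Units.ext
    rw [val_smul, ← hc, coe_unitsIncl, AlgEquiv.commutes]
  have hsq : u ^ 2 = Herbrand.norm (L ≃ₐ[K] L) u := by
    rw [Herbrand.norm_apply, Finset.prod_congr rfl fun g _ => hfix g, Finset.prod_const, Finset.card_univ, hcard]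
  have hsqH : u ^ 2 ∈ H := ⟨(unitsE L).pow_mem hu.1 2, ⟨u, Subgroup.mem_top u, hsq.symm⟩⟩
  -- the coset of `u` in `E / (H ⊓ E)` has order `2`
  haveI : Fact (Nat.Prime 2) := ⟨Nat.prime_two⟩
  have huE : u ∈ E := hu
  set q : E ⧸ H.subgroupOf E := QuotientGroup.mk ⟨u, huE⟩ with hq
  have hq1 : q ≠ 1 := by
    intro h1
    rw [hq, QuotientGroup.eq_one_iff, Subgroup.mem_subgroupOf] at h1
    exact hnot h1
  have hq2 : q ^ 2 = 1 := by
    rw [hq, ← QuotientGroup.mk_pow, QuotientGroup.eq_one_iff, Subgroup.mem_subgroupOf]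
    exact hsqH
  have hord : orderOf q = 2 := orderOf_eq_prime hq2 hq1
  rw [Subgroup.relIndex, Subgroup.index, ← hord]
  exact orderOf_dvd_natCard q

/-- **Chevalley at `p = 2`: `2 ∤ h_L`.** Let `L/K` be Galois of degree `2`, unramified at the infinite places, with `h_K` odd, at most two
primes of `K` ramified in `L`, and a unit of `K` that is not a norm from `L`. Lang's Lemma 4.1 reads `#Cl(L)^G · 2 · [E_K : E_K ∩ N Lˣ] =
h_K · 2^t` (`t ≤ 2` ramified primes, `e_∞ = 1`); the index being even forces `t = 2` and `#Cl(L)^G ∣ h_K` odd, and the `2`-group `G` then has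
no fixed point on `Cl(L)[2] ∖ {1}`, so `2 ∤ h_L`. [cite: Lang1990, Ch. 13 §4, Lemma 4.1 (PDF p. 203)] [cite: Gras2003, II.6.2.3] -/
theorem not_two_dvd_classNumber_of_nonNorm_unit [IsGalois K L] [IsUnramifiedAtInfinitePlaces K L]
    (hdeg : Module.finrank K L = 2) (hK : ¬ 2 ∣ classNumber K)
    (ht : {v : HeightOneSpectrum (𝓞 K) | v.asIdeal.ramificationIdxIn (𝓞 L) ≠ 1}.ncard ≤ 2) {u : Lˣ}
    (hu : u ∈ unitsE L ⊓ (unitsIncl K L).range)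
    (hnot : u ∉ unitsE L ⊓ (⊤ : Subgroup Lˣ).map (Herbrand.norm (L ≃ₐ[K] L))) : ¬ 2 ∣ classNumber L := by
  classical
  haveI : FiniteDimensional K L := Module.Finite.of_restrictScalars_finite ℚ K L
  have hcard : Nat.card (L ≃ₐ[K] L) = 2 := by rw [IsGalois.card_aut_eq_finrank, hdeg]
  haveI : Fact (Nat.Prime 2) := ⟨Nat.prime_two⟩
  haveI : IsCyclic (L ≃ₐ[K] L) := isCyclic_of_prime_card hcard
  obtain ⟨σ, hσ⟩ := IsCyclic.exists_generator (α := L ≃ₐ[K] L)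
  have h := ambiguousClassNumberFormula hσ
  rw [archFactor_eq_one, mul_one, finprod_ramificationIdxIn_eq_pow_of_prime Nat.prime_two hdeg, hdeg] at h
  set t := {v : HeightOneSpectrum (𝓞 K) | v.asIdeal.ramificationIdxIn (𝓞 L) ≠ 1}.ncard with htdef
  set F := Nat.card {c : ClassGroup (𝓞 L) // ∀ τ : L ≃ₐ[K] L, ClassGroup.mulEquiv (intAut τ) c = c} with hF
  set idx := (unitsE L ⊓ (⊤ : Subgroup Lˣ).map (Herbrand.norm (L ≃ₐ[K] L))).relIndex (unitsE L ⊓ (unitsIncl K L).range)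
    with hidx
  obtain ⟨m, hm⟩ := two_dvd_relIndex_of_nonNorm hdeg hu hnot
  rw [← hidx] at hm
  rw [hm] at h
  -- `F * 2 * (2 m) = h_K * 2^t`, `t ≤ 2`, `h_K` odd ⟹ `t = 2` and `F * m = h_K`
  have hF : ¬ 2 ∣ F := by
    intro hF2
    obtain ⟨F', hF'⟩ := hF2
    rw [hF'] at h
    interval_cases t
    · -- `t = 0`: `8 F' m = h_K`
      apply hK; exact ⟨4 * F' * m, by rw [pow_zero, mul_one] at h; linarith⟩
    · apply hK; exact ⟨2 * F' * m, by rw [pow_one] at h; linarith⟩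
    · apply hK; exact ⟨F' * m, by linarith⟩
  have hG : IsPGroup 2 (L ≃ₐ[K] L) := IsPGroup.of_card (n := 1) (by rw [pow_one, hcard])
  exact not_dvd_classNumber_of_isPGroup_of_not_dvd_card_fixed hG hF

end Chevalley


/-! ## §3 The first layer of the cyclotomic `ℤ₂`-extension of a field of odd degree -/

section LayerOne

variable {K : Type} [Field K] [NumberField K]

/-- `2` is not a square in a number field of odd degree (`N(c)² = 2^{[K:ℚ]}` is impossible in `ℚ` for an odd exponent).
[folklore] -/
theorem sq_ne_two_of_odd_finrank (hK2 : ¬ 2 ∣ Module.finrank ℚ K) (c : K) : c ^ 2 ≠ 2 := by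
  intro hc
  have hN : Algebra.norm ℚ c ^ 2 = 2 ^ Module.finrank ℚ K := by
    rw [← map_pow, hc, show (2 : K) = algebraMap ℚ K 2 from by norm_num, Algebra.norm_algebraMap]
  obtain ⟨k, hk⟩ := Nat.odd_iff.mpr (Nat.two_dvd_ne_zero.mp hK2)
  have hN' : Algebra.norm ℚ c ^ 2 = 2 * (2 ^ k) ^ 2 := by rw [hN, hk]; ring
  set r : ℚ := Algebra.norm ℚ c / 2 ^ k with hr
  have hr2 : r ^ 2 = 2 := by
    rw [hr, div_pow, hN']; field_simp
  -- `√2` would be rational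
  have hirr := irrational_sqrt_two
  apply hirr.ne_rat |r|
  rw [Rat.cast_abs, ← Real.sqrt_sq_eq_abs, ← Rat.cast_pow, hr2]
  norm_num

/-- **CHEVALLEY'S DOOR AT `p = 2`**: for a number field `K` of ODD degree, a cyclotomic `ℤ₂`-extension `κ` of `K`, `h_K` odd, at most two
primes of `K` above `2`, and a unit `ε ∈ 𝓞 K` that is not of the form `a² − 2b²` (`a, b ∈ K`) — i.e. not a norm from the first layer
`K₁ = K(√2)` — the class number of `K₁` is odd: **`e₁(κ) = 0`**. (`[K₁ : K] = 2` and `√2 ∈ K₁` by the tree's layer-one analysis, p687770;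
`K₁ = K ⊕ K√2`, `σ(√2) = −√2`, `N(a + b√2) = a² − 2b²`; §1 gives `e_∞ = 1`, the tree's `isUnramifiedIn_layer_of_not_mem` gives `t ≤ 2`,
and §2 concludes.) [cite: Lang1990, Ch. 13 §4, Lemma 4.1] [cite: Washington1997, §13.1] -/
theorem classNumberPExp_one_eq_zero_of_nonNorm_unit_two (hK2 : ¬ 2 ∣ Module.finrank ℚ K) (κ : ZpExtension K 2)
    (hκ : κ.IsCyclotomic) (hh : ¬ 2 ∣ classNumber K)
    (hs : {v : HeightOneSpectrum (𝓞 K) | ((2 : ℕ) : 𝓞 K) ∈ v.asIdeal}.ncard ≤ 2)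
    {ε : 𝓞 K} (hεu : IsUnit ε) (hnn : ∀ a b : K, (ε : K) ≠ a ^ 2 - 2 * b ^ 2) : classNumberPExp κ 1 = 0 := by
  classical
  haveI : FiniteDimensional K (κ.layer 1) := κ.finiteDimensional_layer_holds 1
  haveI : IsGalois K (κ.layer 1) := κ.isGalois_layer_holds 1
  haveI : NumberField (κ.layer 1) := NumberField.of_module_finite K (κ.layer 1)
  set L := κ.layer 1 with hL
  have hdeg : Module.finrank K L = 2 := by rw [hL, κ.finrank_layer_holds 1, pow_one]
  obtain ⟨s, hs2⟩ := exists_sq_eq_two_layer_one_of_not_dvd_finrank hK2 κ hκ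
  -- `s ∉ K`
  have hsK : ∀ c : K, algebraMap K L c ≠ s := by
    intro c hc
    apply sq_ne_two_of_odd_finrank hK2 c
    apply (algebraMap K L).injective
    rw [map_pow, hc, hs2, map_ofNat]
  -- `{1, s}` is a `K`-basis of `L`
  have hli : LinearIndependent K ![(1 : L), s] := by
    refine LinearIndependent.pair_iff.mpr fun a b hab => ?_
    by_cases hb : b = 0
    · subst hb
      simp only [zero_smul, add_zero, smul_eq_zero, one_ne_zero, or_false] at hab
      exact ⟨hab, rfl⟩
    · exfalso
      apply hsK (-(a / b))
      rw [Algebra.smul_def, Algebra.smul_def, mul_one] at hab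
      have hb' : algebraMap K L b ≠ 0 := by rwa [Ne, map_eq_zero]
      rw [map_neg, map_div₀, ← neg_div, div_eq_iff hb']
      linear_combination (-1 : L) * hab
  have hspan : ∀ x : L, ∃ a b : K, x = algebraMap K L a + algebraMap K L b * s := by
    intro x
    let B : Module.Basis (Fin 2) K L := basisOfLinearIndependentOfCardEqFinrank hli (by simp [hdeg])
    have hB : ∀ i, B i = ![(1 : L), s] i := fun i => by simp [B, coe_basisOfLinearIndependentOfCardEqFinrank]
    refine ⟨B.repr x 0, B.repr x 1, ?_⟩
    conv_lhs => rw [← B.sum_repr x]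
    rw [Fin.sum_univ_two, hB, hB, Algebra.smul_def, Algebra.smul_def]
    simp
  haveI : IsUnramifiedAtInfinitePlaces K L := isUnramifiedAtInfinitePlaces_of_sq_eq_two hs2 hspan
  -- the generator `σ` and `σ s = -s`
  have hcard : Nat.card (L ≃ₐ[K] L) = 2 := by rw [IsGalois.card_aut_eq_finrank, hdeg]
  haveI : Fact (Nat.Prime 2) := ⟨Nat.prime_two⟩
  haveI : IsCyclic (L ≃ₐ[K] L) := isCyclic_of_prime_card hcard
  obtain ⟨σ, hσ⟩ := IsCyclic.exists_generator (α := L ≃ₐ[K] L)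
  have hσ1 : σ ≠ 1 := by
    intro h1
    have : Nat.card (L ≃ₐ[K] L) = 1 := by
      rw [Nat.card_eq_one_iff_exists]
      refine ⟨1, fun g => ?_⟩
      obtain ⟨k, hk⟩ := Subgroup.mem_zpowers_iff.mp (hσ g)
      rw [← hk, h1, one_zpow]
    omega
  have hσs : σ s = -s := by
    have hsq : (σ s - s) * (σ s + s) = 0 := by
      have : σ s ^ 2 = 2 := by rw [← map_pow, hs2, map_ofNat]
      linear_combination this - hs2
    rcases mul_eq_zero.mp hsq with h0 | h0
    · exfalso
      apply hσ1
      have hfix : σ s = s := by linear_combination h0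
      ext x
      obtain ⟨a, b, rfl⟩ := hspan x
      rw [map_add, map_mul, AlgEquiv.commutes, AlgEquiv.commutes, hfix, AlgEquiv.one_apply]
    · linear_combination h0
  have huniv : (Finset.univ : Finset (L ≃ₐ[K] L)) = {1, σ} := by
    symm
    apply Finset.eq_univ_of_card
    rw [Finset.card_pair hσ1.symm, ← Nat.card_eq_fintype_card, hcard]
  -- the unit `u = ι(ε)`
  have hε0 : (ε : K) ≠ 0 := by
    intro h0
    have : ε = 0 := by exact_mod_cast h0
    exact hεu.ne_zero this
  set u : Lˣ := unitsIncl K L (Units.mk0 (ε : K) hε0) with hu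
  have huE : u ∈ unitsE L ⊓ (unitsIncl K L).range := by
    refine ⟨?_, ⟨_, rfl⟩⟩
    haveI : IsScalarTower (𝓞 K) (𝓞 L) L := IsScalarTower.of_algebraMap_eq fun x => rfl
    refine ⟨Units.map (algebraMap (𝓞 K) (𝓞 L)).toMonoidHom hεu.unit, Units.ext ?_⟩
    change algebraMap (𝓞 L) L (algebraMap (𝓞 K) (𝓞 L) (hεu.unit : 𝓞 K)) = algebraMap K L (ε : K)
    rw [IsUnit.unit_spec, ← IsScalarTower.algebraMap_apply, IsScalarTower.algebraMap_apply (𝓞 K) K L]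
  have hnot : u ∉ unitsE L ⊓ (⊤ : Subgroup Lˣ).map (Herbrand.norm (L ≃ₐ[K] L)) := by
    rintro ⟨-, y, -, hy⟩
    obtain ⟨a, b, hab⟩ := hspan (y : L)
    apply hnn a b
    apply (algebraMap K L).injective
    have hval := congrArg (fun z : Lˣ => (z : L)) hy
    rw [Herbrand.norm_apply, huniv, Finset.prod_pair hσ1.symm, Units.val_mul, val_smul, val_smul, AlgEquiv.one_apply,
      hab, map_add, map_mul, AlgEquiv.commutes, AlgEquiv.commutes, hσs] at hval
    rw [hu, coe_unitsIncl, Units.val_mk0] at hval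
    rw [← hval, map_sub, map_mul, map_pow, map_pow, map_ofNat]
    linear_combination (-(algebraMap K L b) ^ 2) * hs2
  -- at most two ramified primes
  have ht : {v : HeightOneSpectrum (𝓞 K) | v.asIdeal.ramificationIdxIn (𝓞 L) ≠ 1}.ncard ≤ 2 := by
    have h20 : Ideal.span {((2 : ℕ) : 𝓞 K)} ≠ ⊥ := by
      rw [Ne, Ideal.span_singleton_eq_bot]; exact_mod_cast Nat.prime_two.ne_zero
    have hfin : {v : HeightOneSpectrum (𝓞 K) | ((2 : ℕ) : 𝓞 K) ∈ v.asIdeal}.Finite := by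
      refine (Ideal.finite_factors h20).subset fun v hv => ?_
      exact (Ideal.dvd_span_singleton).mpr hv
    refine le_trans (Set.ncard_le_ncard (fun v hv => ?_) hfin) hs
    by_contra hpv
    apply hv
    have hunr := κ.isUnramifiedIn_layer_of_not_mem 1 hpv
    haveI : v.asIdeal.IsPrime := v.isPrime
    obtain ⟨⟨P, hPprime, hPover⟩⟩ := (inferInstance : Nonempty (Ideal.primesOver v.asIdeal (𝓞 L)))
    haveI := hPprime
    haveI := hPover
    rw [Ideal.ramificationIdxIn_eq_ramificationIdx v.asIdeal P (L ≃ₐ[K] L)]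
    exact hunr.ramificationIdx_eq_one hPover
  -- Chevalley
  rw [classNumberPExp_eq_padicValNat_classNumber]
  exact padicValNat.eq_zero_of_not_dvd (not_two_dvd_classNumber_of_nonNorm_unit hdeg hh ht huE hnot)

end LayerOne

end Summit.BirchSwinnertonDyer.BirchSwinnertonDyer.Theorems.AddKatoTwo

end
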